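import Summits.CriticalPhenomena.PercolationContinuityZ3.Theorems.Transplant.FKConnectivityAllQDualTransport
import Summits.CriticalPhenomena.PercolationContinuityZ3.Theorems.Transplant.FKConnectivityAllQFastEvalBridge
import Summits.CriticalPhenomena.PercolationContinuityZ3.Theorems.Transplant.FKConnectivityAllQK5Disj
import Summits.CriticalPhenomena.PercolationContinuityZ3.Theorems.Transplant.FKConnectivityAllQEmbedding
import HarnessLib

/-!
# Connectivity correlation inequalities for `φ_{w,q}`, every `q > 0` — THE TRIANGULAR PRISM `K₃ □ K₂` IS POTTS–RAYLEIGH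
# for every `0 < q ≤ 1` (planar dual of `K₅⁻`; first user of the duality transport)

Support file (`--supports stmt-CriticalPhenomena-4575`), FK sub-lane `prim-bschramm-fk-3` (gen 19) of the post-continuity programme;
builds on p205010 (kernel theorem, internal audit signed; external expert review pending).  Definitions = two listed graphs
(`FK.prismD`, `FK.k5mD`); no named facts, no sorries; standard axioms (one `decide +kernel` over `2⁹` masks on fk-1 g17's verified
evaluator `RCEval.kOf`; no `native_decide`).

THE GRAPH.  The prism `K₃ □ K₂` (triangles `012`, `345`, rungs `03, 14, 25`; 6 vertices, 9 edges, 3-connected, planar, vertex cover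
4) is the first 6-vertex 3-connected graph outside the families for which the `q < 1` programme had edge-negative association
(`≤ 5` vertices fk-3 g11, wheels g8, vertex cover `≤ 3` g18, 2-trees/`K₄` and their parallel connections fk-1 g5–g6).  Its plane
dual is `K₅⁻` (outer face `0`, inner face `1`, the three quadrilaterals `2, 3, 4`; the two triangular faces are not adjacent), which
is Potts–Rayleigh on `(0,1]` by fk-3 g11's `K₅` theorem `FK.edgeNegCorrOn_fin_five`.  Listing the nine prism edges and the nine
dual edges with MATCHING indices (`prismD.edge i` crosses `k5mD.edge i`), Euler's formula becomes the finite identity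
`k₆(prism t) + |t| = k₅(K₅⁻ tᶜ) + 5` for all `t ⊆ Fin 9` (`prism_dual_count`, `decide +kernel` on bitmasks; bridged to `clusterCount`
by `RCEval.kOf_eq_clusterCount`, `tOf_maskOf`, `tOf_xor`), and fk-3 g19's `FK.Dual.edgeNegCorrSupp_of_dual` transports the `K₅⁻`
theorem across the duality:
* **`FK.Prism.edgeNegCorrSupp_prism`** (`0 < q ≤ 1`): `EdgeNegCorrSupp (range prismD.edge) q` on `Fin 6` — every weight vector
  supported on the prism gives an edge-negatively associated `φ_{w,q}`;
* **`FK.Prism.edgeNegCorrSupp_prism_map`**: the same for every copy `Sym2.map j '' …` of the prism along an injection `j : Fin 6 ↪ U`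
  into any finite vertex type (idle vertices do not matter, fk-3 g8's `EdgeNegCorrSupp.image`).
With the tree's closure under parallel connection / 2-sums (`FK.edgeNegCorrSupp_parallelConnection`) and subsets (`EdgeNegCorrSupp.mono`)
this adds every graph whose 3-connected pieces are prisms, wheels, `≤ 5`-vertex or vertex-cover-`≤ 3` graphs.
[cite: Grimmett2006, §6.1 eq. (6.1)–(6.6) (pp. 133–134); §3.9 eq. (3.94) (pp. 63–64)] [cite: Wagner2006, Thm. 5.8, §5.3 (pp. 14–15)]
-/

namespace Summit.CriticalPhenomena.PercolationContinuityZ3.Theorems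

namespace FK

open Literature.Probability.LatticeModels Literature.Probability.Percolation

/-- **The prism `K₃ □ K₂` as a listed graph** on `Fin 6`: pairs `01, 12, 02, 34, 45, 35, 03, 14, 25` (indices `0..8`); parameters
unused (`0`), `q = 1`. [folklore] -/
abbrev prismD : RCEval where
  n := 6
  m := 9
  src := ![0, 1, 0, 3, 4, 3, 0, 1, 2]
  dst := ![1, 2, 2, 4, 5, 5, 3, 4, 5]
  c := fun _ => 0
  q := 1

/-- **`K₅⁻` as the plane dual of the prism**, listed on `Fin 5` (faces: `0` outer triangle, `1` inner triangle, `2, 3, 4` the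
quadrilaterals through the rungs `03∧14`, `14∧25`, `03∧25`) so that `k5mD.edge i` is the dual edge crossing `prismD.edge i`:
pairs `02, 03, 04, 12, 13, 14, 24, 23, 34` (all pairs of `Fin 5` except `01`). [cite: Grimmett2006, §6.1 (p. 133)] -/
abbrev k5mD : RCEval where
  n := 5
  m := 9
  src := ![0, 0, 0, 1, 1, 1, 2, 2, 3]
  dst := ![2, 3, 4, 2, 3, 4, 4, 3, 4]
  c := fun _ => 0
  q := 1

namespace Prism

open RCEval

/-! ### The finite facts (kernel evaluation) -/

/-- The prism listing is valid (pairs distinct). [folklore] -/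
theorem valid_prism : prismD.Valid := by decide +kernel

/-- The dual listing is valid (pairs distinct). [folklore] -/
theorem valid_k5m : k5mD.Valid := by decide +kernel

/-- The dual listing has no loops. [folklore] -/
theorem k5m_noloop : ∀ i : Fin 9, ¬ (k5mD.edge i).IsDiag := by decide +kernel

/-- **Euler's formula for the prism and its dual, as a finite identity on bitmasks**: for every mask `a < 2⁹`,
`k₆(prism edges in a) + |a| = k₅(dual edges NOT in a) + 5`. [cite: Grimmett2006, §6.1 eq. (6.1)–(6.2) (p. 133)] -/
theorem prism_dual_count : ∀ a < 2 ^ 9, prismD.kOf a + prismD.popc a = k5mD.kOf (Nat.xor (2 ^ 9 - 1) a) + 5 := by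
  decide +kernel

/-! ### The abstract duality hypothesis `hk` -/

/-- Index sets of `Fin 9` as masks agree for the two listings (both have `m = 9`). [folklore] -/
theorem tOf_k5m_eq (a : ℕ) : k5mD.tOf a = prismD.tOf a := rfl

/-- All nine indices are "first" indices: `firstT 9 = univ`. [folklore] -/
theorem firstT_nine : prismD.firstT 9 = Finset.univ := by
  ext i
  simp only [mem_firstT (D := prismD), i.isLt, Finset.mem_univ]

/-- **The prism and `K₅⁻` are abstractly dual with constant `5`**: `k(prism '' t) + |t| = k(K₅⁻ '' tᶜ) + 5` for every `t ⊆ Fin 9`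
(bridge from the bitmask identity through `kOf_eq_clusterCount`, `tOf_maskOf`, `tOf_xor`). [cite: Grimmett2006, §6.1 eq. (6.1)–(6.2) (p. 133)] -/
theorem clusterCount_dual (t : Finset (Fin 9)) :
    clusterCount (prismD.conf t) ∅ + t.card = clusterCount (k5mD.conf tᶜ) ∅ + 5 := by
  have ha : prismD.maskOf t < 2 ^ 9 := maskOf_lt (D := prismD) (d := 9) (by rw [firstT_nine]; exact Finset.subset_univ t)
  have h1 : prismD.tOf (prismD.maskOf t) = t := tOf_maskOf (D := prismD) t
  have h2 : k5mD.tOf (Nat.xor (2 ^ 9 - 1) (prismD.maskOf t)) = tᶜ := by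
    rw [tOf_xor (D := k5mD) 9 _ ha, tOf_k5m_eq, h1, show k5mD.firstT 9 = Finset.univ from firstT_nine,
      Finset.compl_eq_univ_sdiff]
  have hc := prism_dual_count _ ha
  rw [kOf_eq_clusterCount (D := prismD), kOf_eq_clusterCount (D := k5mD), popc_eq_card (D := prismD), h1, h2] at hc
  exact hc

/-! ### The prism is Potts–Rayleigh -/

/-- `K₅⁻ ⊆ K₅` is Potts–Rayleigh on `(0,1]` (fk-3 g11's `K₅` theorem, support form). [cite: Wagner2006, §5.3 (p. 15)] -/
theorem edgeNegCorrSupp_k5m {q : ℝ} (hq0 : 0 < q) (hq1 : q ≤ 1) : EdgeNegCorrSupp (Set.range k5mD.edge) q :=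
  EdgeNegCorrSupp.mono (Set.subset_univ _) (edgeNegCorrSupp_univ_of_edgeNegCorrOn (edgeNegCorrOn_fin_five hq0 hq1))

/-- **The triangular prism `K₃ □ K₂` is Potts–Rayleigh for every `0 < q ≤ 1`**: every weight vector on `Fin 6` supported on the
nine prism pairs gives an edge-negatively associated `φ_{w,q}` — planar duality (fk-3 g19) applied to `K₅⁻` (fk-3 g11).
[cite: Grimmett2006, §6.1 eq. (6.1)–(6.6) (pp. 133–134); §3.9 eq. (3.94) (p. 63)] [cite: Wagner2006, Thm. 5.8, §5.3 (pp. 14–15)] -/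
theorem edgeNegCorrSupp_prism {q : ℝ} (hq0 : 0 < q) (hq1 : q ≤ 1) : EdgeNegCorrSupp (Set.range prismD.edge) q := by
  classical
  refine Dual.edgeNegCorrSupp_of_dual (e := prismD.edge) (e' := k5mD.edge) valid_prism.1 valid_k5m.1 k5m_noloop hq0 5
    (fun t => ?_) (edgeNegCorrSupp_k5m hq0 hq1)
  convert clusterCount_dual t using 3 <;> simp [RCEval.conf]

variable {U : Type*} [Fintype U]

/-- **Every copy of the prism in a finite vertex type is Potts–Rayleigh on `(0,1]`**: along an injection `j : Fin 6 ↪ U`, every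
weight vector on `U` supported on the nine image pairs gives an edge-negatively associated `φ_{w,q}`.
[cite: Grimmett2006, §6.1 eq. (6.1)–(6.6) (pp. 133–134); §3.9 eq. (3.94) (p. 63)] [cite: Wagner2006, Thm. 5.8, §5.3 (pp. 14–15)] -/
theorem edgeNegCorrSupp_prism_map (j : Fin 6 ↪ U) {q : ℝ} (hq0 : 0 < q) (hq1 : q ≤ 1) :
    EdgeNegCorrSupp (Sym2.map j '' Set.range prismD.edge) q :=
  (edgeNegCorrSupp_prism hq0 hq1).image j hq0

omit [Fintype U] in
/-- The nine prism pairs on six listed vertices `v 0, …, v 5` of `U` (triangles `v0 v1 v2`, `v3 v4 v5`, rungs `v0 v3`, `v1 v4`,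
`v2 v5`), as an explicit set. [folklore] -/
theorem range_map_prism_eq (j : Fin 6 ↪ U) :
    Sym2.map j '' Set.range prismD.edge =
      {s(j 0, j 1), s(j 1, j 2), s(j 0, j 2), s(j 3, j 4), s(j 4, j 5), s(j 3, j 5), s(j 0, j 3), s(j 1, j 4), s(j 2, j 5)} := by
  ext g
  simp only [Set.mem_image, Set.mem_range, exists_exists_eq_and, Set.mem_insert_iff, Set.mem_singleton_iff]
  constructor
  · rintro ⟨i, rfl⟩
    fin_cases i <;> simp [RCEval.edge]
  · rintro (rfl | rfl | rfl | rfl | rfl | rfl | rfl | rfl | rfl)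
    · exact ⟨0, by simp [RCEval.edge]⟩
    · exact ⟨1, by simp [RCEval.edge]⟩
    · exact ⟨2, by simp [RCEval.edge]⟩
    · exact ⟨3, by simp [RCEval.edge]⟩
    · exact ⟨4, by simp [RCEval.edge]⟩
    · exact ⟨5, by simp [RCEval.edge]⟩
    · exact ⟨6, by simp [RCEval.edge]⟩
    · exact ⟨7, by simp [RCEval.edge]⟩
    · exact ⟨8, by simp [RCEval.edge]⟩

/-- **The prism on any six distinct vertices is Potts–Rayleigh on `(0,1]`** (explicit-set form).
[cite: Grimmett2006, §6.1 eq. (6.1)–(6.6) (pp. 133–134); §3.9 eq. (3.94) (p. 63)] [cite: Wagner2006, Thm. 5.8, §5.3 (pp. 14–15)] -/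
theorem edgeNegCorrSupp_prism_six (j : Fin 6 ↪ U) {q : ℝ} (hq0 : 0 < q) (hq1 : q ≤ 1) :
    EdgeNegCorrSupp ({s(j 0, j 1), s(j 1, j 2), s(j 0, j 2), s(j 3, j 4), s(j 4, j 5), s(j 3, j 5), s(j 0, j 3), s(j 1, j 4),
      s(j 2, j 5)} : Set (Sym2 U)) q := by
  rw [← range_map_prism_eq j]
  exact edgeNegCorrSupp_prism_map j hq0 hq1

end Prism

end FK

end Summit.CriticalPhenomena.PercolationContinuityZ3.Theorems
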